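import Literature.AlgebraicGeometry.AbelianSchemes.AbelianSchemeTotalSpaceSmoothProjective
import Literature.AlgebraicGeometry.AbelianSchemes.AbelianSchemeTotalSpaceQuasiProjectiveBaseChange
import Literature.AlgebraicGeometry.ModuliOfAbelianVarieties.SiegelModuliUniversalFamilyQuasiProjective
import Literature.AlgebraicGeometry.HodgeTheory.RelativeHyperplaneClassHodgeRiemann
import Literature.AlgebraicGeometry.HodgeTheory.GlobalInvariantCycles
import Literature.AlgebraicGeometry.Motives.VarietiesProperProofs
import Literature.NumberTheory.Transcendental.AnalytificationExistenceProofs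
import Literature.Geometry.ComplexAnalytic.RelativeExponentialUniformisation
import HarnessLib

/-!
# The universal Siegel family pulled back to a smooth projective curve piece of `𝓜_ℂ`: smooth projective total space and
# analytifications ([MumfordFogartyKirwan1994] Thm. 7.9; [Hartshorne1977] II §4; [SerreGAGA1956] §2)

Topic `AlgebraicGeometry/ModuliOfAbelianVarieties`; namespace `Literature.AlgebraicGeometry.ModuliOfAbelianVarieties.SiegelFineModuliScheme`.
THEOREMS ONLY (no definition, no named fact, no instance, no notation, no `sorry`; net Literature debt 0).  Cell `hodgecm-mathlib` (D-0151),
FLOOR 0, P6 E-line socket `stub_E6`, Σ-AN half (skeleton `Cruxes/HLiu418/F0P6aSigmaAN` v1sf of A-p04 (g24), stub **`stub_PIECEFAM`**): the three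
ENVIRONMENTAL inputs `hTot`, `(MT, φT, hT)`, `(MA, φA, hA)` of ★ PIECES-fam `exists_isMonHom_family_reads_of_piece` (p847655) ∕ ★ COV-6 at the E-line piece tuple
`P := 𝓜.univ.baseChange (ψ.left ≫ ιc.left ≫ pullback.fst 𝓜.M.hom (Spec.map (algebraMap ℚ ℂ)))` over a disc quotient `T` (smooth projective curve over `ℂ`):
* `isSmoothProjective_totalOver_univ_curvePiece` — the total space `P.A → T → Spec ℂ` is a smooth projective variety of dimension `1 + g`
  (★ E6-Π `isSmoothProjective_total`: `T` smooth projective of dimension `1`, `P.relDim`, and quasi-projectivity of the total space by ★ E6-Π §2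
  `isQuasiProjectiveOver_total_baseChange_of_tower` from (F-c″) ★ `isQuasiProjectiveOver_univ`);
* `exists_isAnalytification_curvePiece`, `exists_isAnalytification_totalOver_univ_curvePiece` — analytifications of `T` and of the total space exist
  (★ `Transcendental.exists_isAnalytification_holds`, Serre GAGA §2), in the binder shape of ★ PIECES-fam.
`--supports stmt-HodgeConjecture-24832`, count-neutral; HC_CM is proved only modulo the printed citations (2 remaining named inputs hLiu418 24832, h413
24833) until rung 0 closes.

## References
* [MumfordFogartyKirwan1994] D. Mumford, J. Fogarty, F. Kirwan, *Geometric Invariant Theory*, 3rd ed. (1994), Ch. 7 §3 Thm. 7.9 (p. 139), Ch. 6 §1 Def. 6.1 (p. 115).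
* [Hartshorne1977] R. Hartshorne, *Algebraic Geometry* (1977), II §4 (p. 103), Cor. 4.8 (p. 102), III Prop. 10.1 (p. 270).
* [SerreGAGA1956] J.-P. Serre, *Géométrie algébrique et géométrie analytique* (1956), §2 n° 5 Prop. 2.
-/

set_option autoImplicit false

noncomputable section

open CategoryTheory CategoryTheory.Limits AlgebraicGeometry
open scoped Manifold ContDiff
open Literature.AlgebraicGeometry.Motives (SchemeOver ComplexPoints IsSmoothProjective)
open Literature.AlgebraicGeometry.AbelianSchemes (PolarizedAbelianSchemeWithLevel AbelianSchemeOver)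
open Literature.AlgebraicGeometry.HodgeTheory (IsQuasiProjectiveOver)
open Literature.Geometry.ComplexAnalytic (totalOver)
open Literature.NumberTheory.Transcendental (IsAnalytification exists_isAnalytification_holds)

universe u

namespace Literature.AlgebraicGeometry.ModuliOfAbelianVarieties

namespace SiegelFineModuliScheme

variable {g N : ℕ} {δ : Fin g → ℕ} (𝓜 : SiegelFineModuliScheme g N δ)

/-- **(E6-Π AT A CURVE PIECE) the total space of the universal family pulled back to a smooth projective curve `T → Sc → 𝓜_ℂ` is a smooth projective
variety of dimension `1 + g` over `ℂ`.**  Inputs: `δ` a polarisation type and `𝓜.M` quasi-projective over `ℚ` ((F-c″) ★ `isQuasiProjectiveOver_univ`: the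
universal total space is quasi-projective), `T` smooth projective of dimension `1` (the disc quotient's `isSmoothProjective`), `ιc : Sc → 𝓜_ℂ`, `ψ : T → Sc`.
Proof: ★ E6-Π §2 `isQuasiProjectiveOver_total_baseChange_of_tower` along `ψ ≫ ιc`, then ★ `isSmoothProjective_total` with `P.relDim`.
[cite: MumfordFogartyKirwan1994, Ch. 7 §3 Theorem 7.9 (p. 139)] [cite: Hartshorne1977, II §4 (p. 103) and III Prop. 10.1 (p. 270)] -/
theorem isSmoothProjective_totalOver_univ_curvePiece (hδ : IsPolarizationType δ) (hqp : IsQuasiProjectiveOver 𝓜.M)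
    {T Sc : SchemeOver ℂ} (hT : IsSmoothProjective 1 T) (ιc : Sc ⟶ (Motives.baseChange ℚ ℂ).obj 𝓜.M) (ψ : T ⟶ Sc) :
    IsSmoothProjective (1 + g) (totalOver T
      (𝓜.univ.baseChange (ψ.left ≫ ιc.left ≫ pullback.fst 𝓜.M.hom (Spec.map (CommRingCat.ofHom (algebraMap ℚ ℂ))))).A) := by
  haveI : IsSeparated 𝓜.M.hom := by
    obtain ⟨P, j, hP, hj⟩ := hqp
    haveI := hj
    haveI : IsProper P.hom := hP.isProper
    rw [← Over.w j]
    infer_instance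
  -- quasi-projectivity of the pulled-back total space (E6-Π §2 along `ψ ≫ ιc`)
  have hq := 𝓜.univ.A.isQuasiProjectiveOver_total_baseChange_of_tower (K := ℂ) (𝓜.isQuasiProjectiveOver_univ hδ hqp) (ψ ≫ ιc)
    (IsQuasiProjectiveOver.of_isProjectiveOver hT.isProjectiveOver)
  have e : (ψ ≫ ιc).left ≫ pullback.fst 𝓜.M.hom (Motives.AbelianVariety.bcSpec ℚ ℂ) =
      ψ.left ≫ ιc.left ≫ pullback.fst 𝓜.M.hom (Spec.map (CommRingCat.ofHom (algebraMap ℚ ℂ))) := by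
    rw [Over.comp_left, Category.assoc]
  rw [e] at hq
  exact AbelianSchemeOver.isSmoothProjective_total _ hT
    (𝓜.univ.baseChange (ψ.left ≫ ιc.left ≫ pullback.fst 𝓜.M.hom (Spec.map (CommRingCat.ofHom (algebraMap ℚ ℂ))))).relDim hq

/-- **An analytification of the curve piece `T` exists** (Serre GAGA §2: `T` is smooth of relative dimension `1`, separated and locally of finite type
over `ℂ`, being smooth projective), in the binder shape `(MT, φT, hT)` of ★ PIECES-fam. [cite: SerreGAGA1956, §2 n° 5 Prop. 2] [cite: Hartshorne1977, II Thm. 4.9 (p. 103)] -/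
theorem exists_isAnalytification_curvePiece {T : SchemeOver ℂ} (hT : IsSmoothProjective 1 T) :
    ∃ (MT : Type) (_ : TopologicalSpace MT) (_ : T2Space MT) (_ : ChartedSpace (Fin 1 → ℂ) MT) (_ : IsManifold 𝓘(ℂ, Fin 1 → ℂ) ω MT)
      (φT : MT → ComplexPoints T), IsAnalytification (Fin 1 → ℂ) T 1 φT := by
  haveI : SmoothOfRelativeDimension 1 T.hom := hT.smoothOfRelativeDimension
  haveI : IsProper T.hom := Motives.IsSmoothProjective.isProper_holds hT
  haveI : IsSeparated T.hom := inferInstance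
  haveI : LocallyOfFiniteType T.hom := inferInstance
  exact exists_isAnalytification_holds T 1

/-- **An analytification of the total space of the pulled-back universal family over the curve piece exists** (Serre GAGA §2 at the smooth projective
`(1 + g)`-fold of `isSmoothProjective_totalOver_univ_curvePiece`), in the binder shape `(MA, φA, hA)` of ★ PIECES-fam.
[cite: SerreGAGA1956, §2 n° 5 Prop. 2] [cite: MumfordFogartyKirwan1994, Ch. 7 §3 Theorem 7.9 (p. 139)] -/
theorem exists_isAnalytification_totalOver_univ_curvePiece (hδ : IsPolarizationType δ) (hqp : IsQuasiProjectiveOver 𝓜.M)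
    {T Sc : SchemeOver ℂ} (hT : IsSmoothProjective 1 T) (ιc : Sc ⟶ (Motives.baseChange ℚ ℂ).obj 𝓜.M) (ψ : T ⟶ Sc) :
    ∃ (MA : Type) (_ : TopologicalSpace MA) (_ : T2Space MA) (_ : ChartedSpace (Fin (1 + g) → ℂ) MA)
      (_ : IsManifold 𝓘(ℂ, Fin (1 + g) → ℂ) ω MA)
      (φA : MA → ComplexPoints (totalOver T
        (𝓜.univ.baseChange (ψ.left ≫ ιc.left ≫ pullback.fst 𝓜.M.hom (Spec.map (CommRingCat.ofHom (algebraMap ℚ ℂ))))).A)),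
      IsAnalytification (Fin (1 + g) → ℂ) (totalOver T
        (𝓜.univ.baseChange (ψ.left ≫ ιc.left ≫ pullback.fst 𝓜.M.hom (Spec.map (CommRingCat.ofHom (algebraMap ℚ ℂ))))).A) (1 + g) φA := by
  have hTot := 𝓜.isSmoothProjective_totalOver_univ_curvePiece hδ hqp hT ιc ψ
  haveI := hTot.smoothOfRelativeDimension
  haveI : IsProper (totalOver T
      (𝓜.univ.baseChange (ψ.left ≫ ιc.left ≫ pullback.fst 𝓜.M.hom (Spec.map (CommRingCat.ofHom (algebraMap ℚ ℂ))))).A).hom :=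
    Motives.IsSmoothProjective.isProper_holds hTot
  haveI : IsSeparated (totalOver T
      (𝓜.univ.baseChange (ψ.left ≫ ιc.left ≫ pullback.fst 𝓜.M.hom (Spec.map (CommRingCat.ofHom (algebraMap ℚ ℂ))))).A).hom := inferInstance
  haveI : LocallyOfFiniteType (totalOver T
      (𝓜.univ.baseChange (ψ.left ≫ ιc.left ≫ pullback.fst 𝓜.M.hom (Spec.map (CommRingCat.ofHom (algebraMap ℚ ℂ))))).A).hom := inferInstance
  exact exists_isAnalytification_holds _ (1 + g)

end SiegelFineModuliScheme

end Literature.AlgebraicGeometry.ModuliOfAbelianVarieties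

end
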